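import Summits.QuantumFields.YangMills.Theorems.BalabanLadderUVSeamRecCeilingsResponseStrongCoupling
import Summits.QuantumFields.YangMills.Theorems.BalabanLadderNTBoundaryLawCentred
import Mathlib.Topology.MetricSpace.Cauchy
import HarnessLib

/-!
# Crux `UVSeamRec` (stmt-QuantumFields-20043), stub `stub_responseMomentsOdd6` (v5(α)): the RESPONSE-MOMENT currency (RM)
# is inhabited by the Wilson state at STRONG coupling, on every odd torus — a format rung

Helper file (`--supports stmt-QuantumFields-20043`) of the width-lever seat `ym-20043-ceilings-p2` (lane B, gen 2); sequel of
p533459 `…CeilingsResponseStrongCoupling.lean` (the BODY of `MomentBounds6` at `|β| < β₁`).  HONEST FRAMING: an UNCONDITIONAL theorem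
in the HIGH-TEMPERATURE regime `|β| < β₁(G, r)` only — a BC5-style witness that the registered v5(α) currency of
`BirthV5A.stub_responseMomentsOdd6` (owner R86k), namely β-uniform joint exponential moments of the rescaled cube responses
`(R⁴/C₁)|kerE_{cube i}(plane_i)(η) − p_i|` with R-INDEPENDENT reference values `p q β`, is inhabited by the actual Wilson state in some
regime; it says nothing about `β → ∞`, the unit clause `a ≤ c·uRec`, E0′ or the gap; not Clay.

* §1 `kerE_plane_trivialExterior_eq` — translation invariance: at the trivial exterior the kernel mean of `plane q x` in the radius-`R+1`
  cube around `x` does not depend on `x`.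
* §2 `exists_referenceValue_smallBeta` — for `|β| < β₁` there is an R-INDEPENDENT reference value `p q β` (`|p| ≤ C_A`) with
  `|kerE_{x−(R+1),2R+3}(plane q x)(η) − p q β| ≤ 2C₁/(R+2)⁴` for EVERY exterior `η`, every `x`, every `R`: the trivial-exterior means form a
  Cauchy sequence in `R` by DLR consistency (`NT.BoundaryLaw.abs_kerE_sub_le_of_subset`) and the Dobrushin–Shlosman oscillation bound
  `NT.BoundaryLaw.bl6osc_smallBeta` (p529847); `p` is its limit.
* §3 **`responseMoments_smallBeta`** — hence (RM)'s BODY at strong coupling: `∃ β₁ > 0, C₁ > 0, P₀, p` with `|p q β| ≤ P₀` and, for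
  `|β| < β₁`, on EVERY odd torus and every family (`1 ≤ R`, `4R+8 ≤ L`, no separation or unit constraint needed),
  `⟨exp(Σ_{i∈T} (R⁴/C₁)|kerE_i(plane_i)(lift ·) − p (q i) β|)⟩_{2L+1,β} ≤ exp(2·#T)`.

References: R. L. Dobrushin, S. B. Shlosman (1985) §2 (via p529847); H.-O. Georgii (2011) Def. 1.23 / Thm. 4.17; K. Osterwalder,
E. Seiler, Ann. Phys. 110 (1978) §4 (strong-coupling regime).
-/

set_option autoImplicit false

noncomputable section

open MeasureTheory Filter Topology Finset
open Literature.Probability.LatticeModels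
open Literature.MathematicalPhysics.QuantumFieldTheory (GaugeConfig wilsonMeasure isProbabilityMeasure_wilsonMeasure
  measurable_torusLift LatticeRep)
open Literature.MathematicalPhysics.QuantumLattice

namespace Summit.QuantumFields.YangMills.Cruxes.UVSeamRec.TemperedResponse

open Summit.QuantumFields.YangMills.Cruxes.OSLegsFromFemtoAndGap.DlrCollarTransfer
open Summit.QuantumFields.YangMills.Cruxes.OSLegsFromFemtoAndGap.DlrCollarTransfer.StubLower (mem_cubeSites_iff)
open Summit.QuantumFields.YangMills.Cruxes.NT.BoundaryLaw (bl6osc_smallBeta abs_kerE_sub_le_of_subset cubeSites_subset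
  cubeEdges_subset kerE_plane_configShift)

variable {G : Type} [Group G] [TopologicalSpace G] [IsTopologicalGroup G] [CompactSpace G]
  [MeasurableSpace G] [BorelSpace G] (r : LatticeRep G)

/-! ## §1 Translation invariance at the trivial exterior -/

omit [TopologicalSpace G] [IsTopologicalGroup G] [CompactSpace G] [BorelSpace G] in
/-- The trivial exterior is translation invariant. [folklore] -/
theorem configShift_one (v : Fin 4 → ℤ) : configShift v (fun _ : ZdEdge 4 => (1 : G)) = fun _ => 1 := by
  funext e
  rw [Literature.MathematicalPhysics.QuantumLattice.configShift_apply]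

/-- **Translation invariance of the trivial-exterior kernel means.**  The kernel mean of `plane q x` in the radius-`R+1` cube around
`x` with the trivial exterior equals the same quantity at `x = 0`. [folklore] -/
theorem kerE_plane_trivialExterior_eq (β : ℝ) (q : Fin 4 × Fin 4) (x : Fin 4 → ℤ) (R : ℕ) :
    kerE G r β (fun k => x k - (R + 1)) (2 * R + 3) (fun _ => 1) (plane G r q x) =
      kerE G r β (fun k => (0 : Fin 4 → ℤ) k - (R + 1)) (2 * R + 3) (fun _ => 1) (plane G r q 0) := by
  have h := kerE_plane_configShift G r x β (fun k => (0 : Fin 4 → ℤ) k - (R + 1)) (2 * R + 3) (fun _ => 1) q 0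
  have hc : ((fun k => (0 : Fin 4 → ℤ) k - ((R : ℤ) + 1)) + x) = fun k => x k - ((R : ℤ) + 1) := by
    funext k
    simp only [Pi.add_apply, Pi.zero_apply]
    ring
  rw [hc, configShift_one, zero_add] at h
  exact h

/-! ## §2 An R-independent reference value at strong coupling -/

omit [TopologicalSpace G] [IsTopologicalGroup G] [CompactSpace G] [MeasurableSpace G] [BorelSpace G] in
/-- Nested centred cubes: the radius-`R+1` cube around `0` sits inside the radius-`R'+1` cube for `R ≤ R'`. [folklore] -/
theorem cubeEdges_centred_subset {R R' : ℕ} (h : R ≤ R') :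
    cubeEdges (fun k => (0 : Fin 4 → ℤ) k - (R + 1)) (2 * R + 3) ⊆
      cubeEdges (fun k => (0 : Fin 4 → ℤ) k - (R' + 1)) (2 * R' + 3) := by
  refine cubeEdges_subset (cubeSites_subset fun j => ⟨?_, ?_⟩)
  · simp only [Pi.zero_apply]
    have : (R : ℤ) ≤ R' := by exact_mod_cast h
    linarith
  · simp only [Pi.zero_apply]
    push_cast
    have : (R : ℤ) ≤ R' := by exact_mod_cast h
    linarith

/-- **R-independent reference values at strong coupling.**  For every compact `G` and lattice representation `r` there are `β₁ > 0`
and `C₁ ≥ 0` (those of `NT.BoundaryLaw.bl6osc_smallBeta`) and reference values `p q β` with `|p q β| ≤ C_A` (the sup of the plane field)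
such that for `|β| < β₁`, every orientation `q`, site `x`, radius `R` and EVERY exterior `η`:
`|kerE_{x−(R+1),2R+3}(plane q x)(η) − p q β| ≤ 2C₁/(R+2)⁴`.  Proof: at the trivial exterior the means `k_R` are x-independent (§1) and
satisfy `|k_{R'} − k_R| ≤ C₁/(R+2)⁴` for `R ≤ R'` (DLR consistency `abs_kerE_sub_le_of_subset` + the oscillation bound at depth `R+2`),
hence converge; `p` is the limit, and the oscillation bound transfers to every exterior. [folklore: Dobrushin–Shlosman regime] -/
theorem exists_referenceValue_smallBeta {CA : ℝ}
    (hCA : ∀ (q : Fin 4 × Fin 4) (x : Fin 4 → ℤ) (U : LGConfig 4 G), |plane G r q x U| ≤ CA) :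
    ∃ β₁ : ℝ, 0 < β₁ ∧ ∃ C₁ : ℝ, 0 ≤ C₁ ∧ ∃ p : Fin 4 × Fin 4 → ℝ → ℝ, (∀ q β, |p q β| ≤ CA) ∧
      ∀ β : ℝ, |β| < β₁ → ∀ (q : Fin 4 × Fin 4) (x : Fin 4 → ℤ) (R : ℕ) (η : LGConfig 4 G),
        |kerE G r β (fun k => x k - (R + 1)) (2 * R + 3) η (plane G r q x) - p q β| ≤ 2 * C₁ / ((R : ℝ) + 2) ^ 4 := by
  classical
  haveI : SecondCountableTopology G :=
    (r.continuous.isClosedEmbedding r.injective).isEmbedding.secondCountableTopology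
  obtain ⟨β₁, hβ₁, C₁, hC₁, H⟩ := bl6osc_smallBeta G r
  -- the trivial-exterior means at the origin
  set k : Fin 4 × Fin 4 → ℝ → ℕ → ℝ := fun q β R =>
    kerE G r β (fun j => (0 : Fin 4 → ℤ) j - (R + 1)) (2 * R + 3) (fun _ => 1) (plane G r q 0) with hk
  have hkb : ∀ q β R, |k q β R| ≤ CA := fun q β R =>
    abs_integral_ymSpecification_le r.ρ r.continuous β _ (hCA q 0) _
  -- oscillation at the centre of the radius-`R+1` cube: depth `R+2`
  have hosc : ∀ β : ℝ, |β| < β₁ → ∀ (q : Fin 4 × Fin 4) (x : Fin 4 → ℤ) (R : ℕ) (η η' : LGConfig 4 G),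
      |kerE G r β (fun j => x j - (R + 1)) (2 * R + 3) η (plane G r q x) -
        kerE G r β (fun j => x j - (R + 1)) (2 * R + 3) η' (plane G r q x)| ≤ C₁ / ((R : ℝ) + 2) ^ 4 := by
    intro β hβ q x R η η'
    have hd : 1 ≤ depth (fun j => x j - (R + 1)) (2 * R + 3) x := by rw [depth_centred]; omega
    have h := H β hβ q _ _ η η' x hd
    rw [depth_centred] at h
    simpa [Nat.cast_add, Nat.cast_ofNat] using h
  -- Cauchy estimate: `|k_{R'} − k_R| ≤ C₁/(R+2)⁴` for `R ≤ R'`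
  have hcauchy : ∀ β : ℝ, |β| < β₁ → ∀ (q : Fin 4 × Fin 4) (R R' : ℕ), R ≤ R' →
      |k q β R' - k q β R| ≤ C₁ / ((R : ℝ) + 2) ^ 4 := by
    intro β hβ q R R' hRR'
    have hin : ∀ ζ : LGConfig 4 G,
        |kerE G r β (fun j => (0 : Fin 4 → ℤ) j - (R + 1)) (2 * R + 3) ζ (plane G r q 0) - k q β R| ≤
          C₁ / ((R : ℝ) + 2) ^ 4 := fun ζ => hosc β hβ q 0 R ζ (fun _ => 1)
    exact abs_kerE_sub_le_of_subset G r β (cubeEdges_centred_subset hRR') (fun _ => 1) (continuous_plane r q 0)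
      (fun U => hCA q 0 U) hin
  -- the limit
  have hconv : ∀ β : ℝ, |β| < β₁ → ∀ q : Fin 4 × Fin 4, CauchySeq (k q β) := by
    intro β hβ q
    refine cauchySeq_of_le_tendsto_0' (fun R : ℕ => C₁ / ((R : ℝ) + 2) ^ 4) (fun R R' hRR' => ?_) ?_
    · rw [Real.dist_eq, abs_sub_comm]
      exact hcauchy β hβ q R R' hRR'
    · have h0 : Tendsto (fun R : ℕ => (R : ℝ) + 2) atTop atTop :=
        tendsto_natCast_atTop_atTop.atTop_add tendsto_const_nhds
      have h1 : Tendsto (fun R : ℕ => ((R : ℝ) + 2) ^ 4) atTop atTop := (tendsto_pow_atTop (by norm_num)).comp h0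
      exact tendsto_const_nhds.div_atTop h1
  set p : Fin 4 × Fin 4 → ℝ → ℝ := fun q β => if |β| < β₁ then limUnder atTop (k q β) else 0 with hp
  have hlim : ∀ β : ℝ, |β| < β₁ → ∀ q, Tendsto (k q β) atTop (𝓝 (p q β)) := by
    intro β hβ q
    simp only [hp, hβ, if_true]
    exact (hconv β hβ q).tendsto_limUnder
  refine ⟨β₁, hβ₁, C₁, hC₁, p, fun q β => ?_, fun β hβ q x R η => ?_⟩
  · by_cases hβ : |β| < β₁
    · exact le_of_tendsto ((hlim β hβ q).abs) (Eventually.of_forall fun R => hkb q β R)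
    · simp only [hp, hβ, if_false, abs_zero]
      exact (abs_nonneg _).trans (hCA (0, 1) 0 fun _ => 1)
  · -- `|k_R − p| ≤ C₁/(R+2)⁴` by passing to the limit in the Cauchy estimate
    have hkp : |k q β R - p q β| ≤ C₁ / ((R : ℝ) + 2) ^ 4 := by
      have ht : Tendsto (fun R' => |k q β R - k q β R'|) atTop (𝓝 |k q β R - p q β|) :=
        (tendsto_const_nhds.sub (hlim β hβ q)).abs
      refine le_of_tendsto ht (eventually_atTop.2 ⟨R, fun R' hRR' => ?_⟩)
      rw [abs_sub_comm]
      exact hcauchy β hβ q R R' hRR'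
    -- translate the trivial-exterior mean to `x`, and combine with the oscillation bound
    have htr : kerE G r β (fun j => x j - (R + 1)) (2 * R + 3) (fun _ => 1) (plane G r q x) = k q β R :=
      kerE_plane_trivialExterior_eq r β q x R
    calc |kerE G r β (fun k => x k - (R + 1)) (2 * R + 3) η (plane G r q x) - p q β|
        ≤ |kerE G r β (fun k => x k - (R + 1)) (2 * R + 3) η (plane G r q x) -
            kerE G r β (fun j => x j - (R + 1)) (2 * R + 3) (fun _ => 1) (plane G r q x)| +
          |kerE G r β (fun j => x j - (R + 1)) (2 * R + 3) (fun _ => 1) (plane G r q x) - p q β| :=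
          abs_sub_le _ _ _
      _ ≤ C₁ / ((R : ℝ) + 2) ^ 4 + C₁ / ((R : ℝ) + 2) ^ 4 := add_le_add (hosc β hβ q x R η _) (by rw [htr]; exact hkp)
      _ = 2 * C₁ / ((R : ℝ) + 2) ^ 4 := by ring

/-! ## §3 (RM)'s body at strong coupling, on every odd torus -/

/-- **The response-moment currency (RM) is inhabited at strong coupling.**  For every compact `G` and lattice representation `r` there
are `β₁ > 0`, `C₁ > 0`, `P₀` and R-INDEPENDENT reference values `p q β` with `|p q β| ≤ P₀` such that for `|β| < β₁`, on EVERY odd torus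
`(ℤ/(2L+1))⁴`, for every `n`, orientations `q i`, sites `x i`, radius `R ≥ 1` with `4R+8 ≤ L` and every index set `T`:
`⟨exp(Σ_{i∈T} (R⁴/C₁)|kerE_{x i−(R+1),2R+3}(plane (q i) (x i))(lift ·) − p (q i) β|)⟩_{2L+1,β} ≤ exp(2·#T)` — the BODY of v5(α)'s
`stub_responseMomentsOdd6` (β-uniform `B = 2`; no separation and no unit constraint are needed in this regime).  Proof: §2 gives the
∀-exterior bound `2C₁'/(R+2)⁴`, so with `C₁ := max C₁' 1` each rescaled response is `≤ 2` pointwise. [folklore: Osterwalder–Seiler /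
Dobrushin–Shlosman strong-coupling regime] -/
theorem responseMoments_smallBeta :
    ∃ β₁ : ℝ, 0 < β₁ ∧ ∃ C₁ : ℝ, 0 < C₁ ∧ ∃ (P₀ : ℝ) (p : Fin 4 × Fin 4 → ℝ → ℝ), (∀ q β, |p q β| ≤ P₀) ∧
      ∀ β : ℝ, |β| < β₁ → ∀ (L n : ℕ) (q : Fin n → Fin 4 × Fin 4) (x : Fin n → (Fin 4 → ℤ)) (R : ℕ),
        1 ≤ R → 4 * R + 8 ≤ L → ∀ T : Finset (Fin n),
          torusE G r β L (fun U => Real.exp (∑ i ∈ T, (R : ℝ) ^ 4 / C₁ *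
            |kerE G r β (fun k => x i k - (R + 1)) (2 * R + 3) U (plane G r (q i) (x i)) - p (q i) β|)) ≤
            Real.exp (2 * T.card) := by
  haveI : SecondCountableTopology G :=
    (r.continuous.isClosedEmbedding r.injective).isEmbedding.secondCountableTopology
  obtain ⟨CA, hCA⟩ := exists_abs_plane_le r
  obtain ⟨β₁, hβ₁, C₁, hC₁, p, hp, H⟩ := exists_referenceValue_smallBeta r hCA
  refine ⟨β₁, hβ₁, max C₁ 1, lt_max_of_lt_right one_pos, CA, p, hp, ?_⟩
  intro β hβ L n q x R hR hRL T
  haveI := isProbabilityMeasure_wilsonMeasure (d := 4) (L := 2 * L + 1) r.ρ r.continuous β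
  have hC : 0 < max C₁ 1 := lt_max_of_lt_right one_pos
  -- pointwise: each rescaled response is at most `2`
  have hpt : ∀ (i : Fin n) (η : LGConfig 4 G),
      (R : ℝ) ^ 4 / max C₁ 1 * |kerE G r β (fun k => x i k - (R + 1)) (2 * R + 3) η (plane G r (q i) (x i)) - p (q i) β|
        ≤ 2 := by
    intro i η
    have h1 := H β hβ (q i) (x i) R η
    have hR0 : (0 : ℝ) < (R : ℝ) := by exact_mod_cast (show 0 < R by omega)
    have hR2 : (R : ℝ) ^ 4 ≤ ((R : ℝ) + 2) ^ 4 := by gcongr; linarith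
    have hR24 : (0 : ℝ) < ((R : ℝ) + 2) ^ 4 := by positivity
    calc (R : ℝ) ^ 4 / max C₁ 1 *
          |kerE G r β (fun k => x i k - (R + 1)) (2 * R + 3) η (plane G r (q i) (x i)) - p (q i) β|
        ≤ (R : ℝ) ^ 4 / max C₁ 1 * (2 * C₁ / ((R : ℝ) + 2) ^ 4) :=
          mul_le_mul_of_nonneg_left h1 (by positivity)
      _ = ((R : ℝ) ^ 4 / ((R : ℝ) + 2) ^ 4) * (2 * (C₁ / max C₁ 1)) := by
          field_simp
      _ ≤ 1 * (2 * 1) := by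
          refine mul_le_mul ((div_le_one hR24).2 hR2) ?_ (by positivity) zero_le_one
          exact mul_le_mul_of_nonneg_left ((div_le_one hC).2 (le_max_left _ _)) (by norm_num)
      _ = 2 := by norm_num
  -- integrate the constant bound
  have hsum : ∀ U : GaugeConfig 4 (2 * L + 1) G,
      Real.exp (∑ i ∈ T, (R : ℝ) ^ 4 / max C₁ 1 *
        |kerE G r β (fun k => x i k - (R + 1)) (2 * R + 3) (torusLift (2 * L + 1) U) (plane G r (q i) (x i)) -
          p (q i) β|) ≤ Real.exp (2 * T.card) := fun U => by
    refine Real.exp_le_exp.2 ?_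
    calc ∑ i ∈ T, (R : ℝ) ^ 4 / max C₁ 1 *
          |kerE G r β (fun k => x i k - (R + 1)) (2 * R + 3) (torusLift (2 * L + 1) U) (plane G r (q i) (x i)) -
            p (q i) β| ≤ ∑ _i ∈ T, (2 : ℝ) := Finset.sum_le_sum fun i _ => hpt i _
      _ = 2 * T.card := by rw [Finset.sum_const, nsmul_eq_mul]; ring
  unfold torusE
  calc ∫ U, Real.exp (∑ i ∈ T, (R : ℝ) ^ 4 / max C₁ 1 *
          |kerE G r β (fun k => x i k - (R + 1)) (2 * R + 3) (torusLift (2 * L + 1) U) (plane G r (q i) (x i)) -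
            p (q i) β|) ∂(wilsonMeasure (d := 4) (L := 2 * L + 1) r.ρ β)
      ≤ ∫ _U, Real.exp (2 * T.card) ∂(wilsonMeasure (d := 4) (L := 2 * L + 1) r.ρ β) :=
        integral_mono_of_nonneg (ae_of_all _ fun U => (Real.exp_pos _).le) (integrable_const _)
          (ae_of_all _ fun U => hsum U)
    _ = Real.exp (2 * T.card) := by simp

end Summit.QuantumFields.YangMills.Cruxes.UVSeamRec.TemperedResponse

end
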